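import Literature.MathematicalPhysics.QuantumFieldTheory.Balaban1983to89.B6SectAOperatorsV1

/-!
# `Balaban1983to89.B6SectATreeGaugeDecompositionV1` — T. Bałaban, *Propagators and renormalization transformations for lattice gauge
# theories. II*, Commun. Math. Phys. **96** (1984) 223–250 [Balaban1984PropagatorsII], (2.7) p. 224 with (2.121) p. 244 and [Balaban1984PropagatorsI]
# (1.7)∕(1.10) pp. 18–19, ON THE V1 MULTI-LEVEL TORUS CALCULUS: **THE AXIAL (TREE) GAUGE DECOMPOSITION `A = B + ∂λ`, `λ ∈ N(Q′)`,
# `B(Γ_{y,x}) = 0` on every block of `𝔅`** — every bond configuration is, modulo the gauge group (2.7), axially gauged block by block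

statement-level skeleton of published theorems with citation tags; proofs where landed; nothing here is a claim about the Yang–Mills mass gap

PDF held: `paper:balaban1984-cmp96-propagators-rt-ii` (journal page = PDF page + 222), pp. 224, 244 (text layer, `lit read … --pages 17-28`, 2026-08-28);
`paper:balaban1984-cmp95-propagators-rt-i` pp. 18–19 through the verbatim quotations of `LatticeFieldCalculus` ∕ `B5Eq120IterProof`.

CITATION HEADER (lean-in-tree rule).  Cell `pub-ymgap` (Track A, HUMAN RULING D-0062), node N10 [B13] lane owner `pub-ymgap-dag-n10-c` (g17), ROAD «C» station
C2 (bus INBOX 2026-08-28T15:23Z; C1 = `B6SectADeltaACoerciveReductionV1`), filed `--supports stmt-QuantumFields-27364` (count-neutral helper).  WHY: C1 reduces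
the volume-uniform coercivity of r03∕p21's `Δ_a` (2.19) to three letters; THIS FILE PROVES the third letter — the decomposition `∀ A ∃ λ ∈ N(Q′), A − ∂λ ∈ 𝒯`
with `𝒯` = the configurations whose staircase sums `B(Γ_{y,x})` vanish on every block of the multi-level partition `𝔅 = ⋃_j Λ_j` — for ANY choice of base
points `y ↦ base_j(y) ∈ B^j(y)` of the blocks (the Lemma-2.4 letter of C4 fixes the base points).  IMPORTS `B6SectAOperatorsV1` (hence `B6SectADomainsV1`,
`B5Eq120IterProof`, `B5Eq118OneStroke`, `LatticeFieldCalculus`); uses BY NAME `stairSum`, `stairSum_grad`, `stairSum_sub`, `stairSum_self`, `iterBlock`,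
`card_iterBlock`, `siteAvgIter_eq_blockSum`, `Domains.exists_lamSite_iterBlockOf`, `Domains.lamSite_iterBlockOf_unique`, `mem_ker_QpE_iff`; nothing restated;
0 `def` (the potential `λ` is built inside the proof).

THE PRINT (verbatim).  [Balaban1984PropagatorsII] p. 224, (2.7): *«λ: A → A^λ = A − ∂λ such that λ = 0 on Λ₀, Q′_jλ = 0 on Λ_j … These gauge transformations
form a group and we consider orbits of this group»*; p. 244, (2.121): *«B(b) = 0 for b ⊂ Γ_{y,x}, x ∈ B(y), y ∈ Λ′»*; [Balaban1984PropagatorsI] p. 18, (1.7):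
the staircase contour `Γ_{y,x}`, and p. 19, (1.10): *«δ_Ax(A) = Π_y Π_{x∈B(y), x≠y} δ(A(Γ_{y,x}))»* (the axial gauge).

THE CONSTRUCTION (ours, elementary).  Every fine site `x` lies over exactly one `Λ_j` ((2.4): `exists_lamSite_iterBlockOf`, `lamSite_iterBlockOf_unique`); put
`φ(x) := c⁻¹·A(Γ_{base_j(y),x})` for `x ∈ B^j(y)`, `y ∈ Λ_j`, and `λ := φ − (block mean of φ)`.  Then `Q′_jλ(y) = 0` on `Λ_j` ((1.20): `Q′_j` is the block mean,
`siteAvgIter_eq_blockSum`), i.e. `λ ∈ N(Q′)`; and `(A − ∂λ)(Γ_{base,x}) = A(Γ) − c(λ(x) − λ(base)) = A(Γ) − (A(Γ_{base,x}) − A(Γ_{base,base})) = 0` (telescoping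
`stairSum_grad`, `Γ_{y,y} = ∅`).  On `Λ₀` (blocks = single sites) `λ = 0`, as (2.7) demands.

WHAT IS PROVED (sorry-free; 0 `def`; standard axioms).  `ofLp_sub_dE` (`A − ∂λ` as a function = `gaugeShift`), `stairSum_sub_dE` (`(A − ∂λ)(Γ_{y,x}) = A(Γ_{y,x}) −
c(λ(x) − λ(y))`), `sum_iterBlock_sub_mean` (a block sum minus `card ×` its mean vanishes), ★★★ `exists_treeGauge_decomposition` (for every nested family `D`,
`c ≠ 0`, every base-point assignment with `base_j(y) ∈ B^j(y)` on `Λ_j`, every `A`: `∃ λ ∈ ker Q′, ∀ j, ∀ y ∈ Λ_j, ∀ x ∈ B^j(y), (A − ∂λ)(Γ_{base_j(y),x}) = 0`), and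
the Set-packaging ★ `exists_treeGauge_decomposition_mem` (`A − ∂λ ∈ {B | …}` — the `hdec` letter of C1's `deltaAE_coercive_of_treeGauge_letters` verbatim).
HONEST SCOPE.  Elementary bookkeeping on the V1 carriers; no inequality of the paper; NOT a node discharge; count-neutral; nothing continuum ∕ OS ∕ mass gap ∕ Clay.
-/

open scoped InnerProductSpace

namespace Literature.MathematicalPhysics.QuantumFieldTheory.Balaban1983to89.B6SectATreeGaugeDecompositionV1

open LatticeFieldCalculus B5Eq118OneStroke B5Eq120IterProof B6SectADomainsV1 B6SectAOperatorsV1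
open BalabanImbrieJaffe1984to88.BIJ85AxialPropagator411 (BondSpace)

noncomputable section

variable {P : Params} (D : Domains P)

/-- `A − ∂λ` read as a bond function is the gauge transform `A^λ` of (2.7). [cite: Balaban1984PropagatorsII, (2.7) p.224] -/
theorem ofLp_sub_dE (c : ℝ) (A : BondSpace P) (n : ScalarSpace P) :
    WithLp.ofLp (A - dE c n) = fun b => WithLp.ofLp A b - grad c (WithLp.ofLp n) b := by
  rw [WithLp.ofLp_sub, ofLp_dE]; rfl

/-- `(A − ∂λ)(Γ_{y,x}) = A(Γ_{y,x}) − c·(λ(x) − λ(y))` (linearity of the contour sum and the telescoping (1.9) along the staircase).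
[cite: Balaban1984PropagatorsI, (1.7)–(1.9) pp.18–19; Balaban1984PropagatorsII, (2.7) p.224] -/
theorem stairSum_sub_dE (c : ℝ) (A : BondSpace P) (n : ScalarSpace P) (y x : Site P 0) :
    stairSum (WithLp.ofLp (A - dE c n)) y x = stairSum (WithLp.ofLp A) y x - c • (WithLp.ofLp n x - WithLp.ofLp n y) := by
  rw [ofLp_sub_dE, stairSum_sub, stairSum_grad]

/-- a finite sum minus `card ×` its mean vanishes. [cite: Balaban1984PropagatorsI, (1.13) p.19 (block means); folklore] -/
theorem sum_sub_mean_eq_zero {ι : Type*} (s : Finset ι) (hs : s.card ≠ 0) (f : ι → ℝ) :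
    ∑ x ∈ s, (f x - (s.card : ℝ)⁻¹ * ∑ z ∈ s, f z) = 0 := by
  rw [Finset.sum_sub_distrib, Finset.sum_const, nsmul_eq_mul, ← mul_assoc, mul_inv_cancel₀ (Nat.cast_ne_zero.mpr hs), one_mul, sub_self]

/-- ★★★ **THE AXIAL-GAUGE DECOMPOSITION ON THE ORBITS OF (2.7).**  For every nested family `D`, lattice factor `c ≠ 0`, and base points `base_j(y) ∈ B^j(y)` of the
blocks `y ∈ Λ_j`: every bond configuration `A` has a `λ ∈ N(Q′) = ker Q′` such that `B := A − ∂λ` satisfies (2.121) on every block of `𝔅`: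
`B(Γ_{base_j(y),x}) = 0` for all `x ∈ B^j(y)`, `y ∈ Λ_j`, all `j`. [cite: Balaban1984PropagatorsII, (2.7) p.224, (2.121) p.244; Balaban1984PropagatorsI, (1.10) p.19] -/
theorem exists_treeGauge_decomposition {c : ℝ} (hc : c ≠ 0) (base : (j : ℕ) → Site P j → Site P 0)
    (hbase : ∀ (j : ℕ) (y : Site P j), D.LamSite j y → base j y ∈ iterBlock j y) (A : BondSpace P) :
    ∃ n ∈ LinearMap.ker (QpE D), ∀ (j : ℕ) (y : Site P j), D.LamSite j y → ∀ x ∈ iterBlock j y,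
      stairSum (WithLp.ofLp (A - dE c n)) (base j y) x = 0 := by
  classical
  -- the level of a fine site and the potential
  let lev : Site P 0 → ℕ := fun x => Classical.choose (D.exists_lamSite_iterBlockOf x)
  have hlev : ∀ x, D.LamSite (lev x) (iterBlockOf (lev x) x) := fun x => (Classical.choose_spec (D.exists_lamSite_iterBlockOf x)).2
  have hlev_eq : ∀ {j : ℕ} {y : Site P j}, D.LamSite j y → ∀ x ∈ iterBlock j y, lev x = j := by
    intro j y hy x hx
    rw [mem_iterBlock] at hx
    exact D.lamSite_iterBlockOf_unique (hlev x) (by rw [hx]; exact hy)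
  -- `φ_j(y, x) = c⁻¹ A(Γ_{base_j y, x})`, block means `m_j(y)`
  let φ : (j : ℕ) → Site P j → Site P 0 → ℝ := fun j y x => c⁻¹ * stairSum (WithLp.ofLp A) (base j y) x
  let m : (j : ℕ) → Site P j → ℝ := fun j y => ((iterBlock j y).card : ℝ)⁻¹ * ∑ z ∈ iterBlock j y, φ j y z
  let f : Site P 0 → ℝ := fun x => φ (lev x) (iterBlockOf (lev x) x) x - m (lev x) (iterBlockOf (lev x) x)
  have hf : ∀ {j : ℕ} {y : Site P j}, D.LamSite j y → ∀ x ∈ iterBlock j y, f x = φ j y x - m j y := by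
    intro j y hy x hx
    have h1 : lev x = j := hlev_eq hy x hx
    have h2 : iterBlockOf j x = y := (mem_iterBlock j y x).mp hx
    show φ (lev x) (iterBlockOf (lev x) x) x - m (lev x) (iterBlockOf (lev x) x) = φ j y x - m j y
    rw [h1, h2]
  let n : ScalarSpace P := WithLp.toLp 2 f
  have hn : WithLp.ofLp n = f := WithLp.ofLp_toLp 2 f
  refine ⟨n, ?_, ?_⟩
  · -- `λ ∈ N(Q′)`: the block means of `λ` vanish on every `Λ_j`
    rw [mem_ker_QpE_iff, hn]
    intro j y hy
    have hj : j ≤ P.m + P.K := (D.le_of_lamSite hy).trans D.hk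
    rw [siteAvgIter_eq_blockSum j hj, Finset.sum_congr rfl (hf hy), smul_eq_mul]
    have hcard : (iterBlock j y).card ≠ 0 := by
      rw [card_iterBlock j hj]; exact pow_ne_zero _ (pow_ne_zero _ P.L_pos.ne')
    rw [sum_sub_mean_eq_zero _ hcard, mul_zero]
  · -- the staircase sums of `A − ∂λ` vanish
    intro j y hy x hx
    have hb := hbase j y hy
    rw [stairSum_sub_dE, hn, hf hy x hx, hf hy _ hb]
    simp only [φ, stairSum_self, mul_zero, zero_sub, sub_neg_eq_add, sub_add_cancel, smul_eq_mul]
    rw [← mul_assoc, mul_inv_cancel₀ hc, one_mul, sub_self]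

/-- ★ the same, packaged as membership in the tree-gauged CLASS `𝒯(base) = {B | B(Γ_{base_j(y),x}) = 0 ∀ x ∈ B^j(y), y ∈ Λ_j, j}` — verbatim the `hdec` letter of
`B6SectADeltaACoerciveReductionV1.deltaAE_coercive_of_treeGauge_letters`. [cite: Balaban1984PropagatorsII, (2.7) p.224, (2.121) p.244] -/
theorem exists_treeGauge_decomposition_mem {c : ℝ} (hc : c ≠ 0) (base : (j : ℕ) → Site P j → Site P 0)
    (hbase : ∀ (j : ℕ) (y : Site P j), D.LamSite j y → base j y ∈ iterBlock j y) (A : BondSpace P) :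
    ∃ n ∈ LinearMap.ker (QpE D), A - dE c n ∈
      {B : BondSpace P | ∀ (j : ℕ) (y : Site P j), D.LamSite j y → ∀ x ∈ iterBlock j y, stairSum (WithLp.ofLp B) (base j y) x = 0} :=
  exists_treeGauge_decomposition D hc base hbase A

end

end Literature.MathematicalPhysics.QuantumFieldTheory.Balaban1983to89.B6SectATreeGaugeDecompositionV1
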